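import Literature.MathematicalPhysics.QuantumFieldTheory.Balaban1983to89.B6Hprime2101TwoScaleV1Torus
import Literature.MathematicalPhysics.QuantumFieldTheory.Balaban1983to89.B6DeltaPrime2110Torus
import Literature.MathematicalPhysics.QuantumFieldTheory.Balaban1983to89.B5Eq112TorusCarriers

/-!
# `Balaban1983to89.B6Ineq2110TwoScaleV1` — T. Bałaban, *Propagators and renormalization transformations for lattice gauge
# theories. II*, Commun. Math. Phys. **96** (1984) 223–250 [Balaban1984PropagatorsII], (2.107)–(2.110) p. 242: **(2.110)
# `γ₀‖ω‖² ≤ ⟨ω, Δ′_jω⟩ ≤ γ₁‖ω‖²` on `Q′₁ω = 0` FOR THE CONCRETE `Δ′_j = H′_j*Δ²H′_j` OF THE TWO-SCALE DATA `tsV1`** — by transport to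
# r03's typed torus `Δ′_j` (`…B6DeltaPrime2110Torus.ineq2110`, `…B6DeltaPrime2109Torus.ineq2109_upper/_top`) along gen 9's dictionary
# `(H′_jμ)~ = HpOp·μ̃` and r02's carrier identification `T^{(j)} ≃ Tor (L·Mc)`

statement-level skeleton of published theorems with citation tags; proofs where landed; nothing here is a claim about the Yang–Mills mass gap

PDF held: `paper:balaban1984-cmp96-propagators-rt-ii` (journal page = PDF page + 222; p. 242 [PDF 20] read AS IMAGE on the ×4 render
`run/shared/lean/pub/pub-balaban/b2b-balaban-ref1/pages/1984-cmp96-propagators-rt-II/…-p020-x4.png`, 2026-08-21).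

PRINT (verbatim, p. 242).  *"… and the operator Δ′_j was defined by the second equality, Δ′_j = H′_j*Δ²H′_j. (2.107) In momentum representation
on the unit lattice the operator Δ′_j is represented as the multiplication operator by the function Δ′_j(p′) = … (2.108) From this we get an
exponential decay of Δ′_j(y − y′) and the bound c₀‖Δ₀ω‖² ≤ ⟨ω, Δ′_jω⟩ ≤ c₁‖Δ₀ω‖² ≤ γ₁‖ω‖². (2.109) For ω satisfying Q′₁ω = 0 the quadratic
form ‖Δ₀ω‖² = ‖Δ₀ω + aQ′₁*Q′₁ω‖² is bounded from below by γ₀′²‖ω‖² because the operator Δ₀ + aQ′₁*Q′₁ is bounded from below by γ₀′ > 0 (in fact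
we may get γ₀′ = π²/L²). Hence γ₀‖ω‖² ≤ ⟨ω, Δ′_jω⟩ ≤ γ₁‖ω‖² for ω : Q′₁ω = 0, (2.110) with positive constants γ₀, γ₁ dependent on d and L only."*

CITATION HEADER (lean-in-tree rule) — WHAT IS REPRODUCED.  Phase-2 file of the `lit-balaban` typed skeleton (HOME
`run/shared/lean/pub/lit-balaban/`), seat **p22 gen 11** (B6 fold owner r03, referee ref-4; lane = the Sect. C chain (2.95)–(2.147) on the
concrete two-scale data `tsV1`).  SKELETON row **B6.Eq2.110** (decl of record r03's `…B6DeltaPrime2110Torus.ineq2110` — (2.110) AS PRINTED for the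
TYPED torus operator `dPOp n (fine (k+1) M)` of (2.108) — untouched; THIS FILE is its model instance for the concrete `Δ′_j` of the V1 two-scale
data, whose every other Sect. C input ((2.118), (2.120)/(2.122), (2.143), (2.147)) is already in the tree for `tsV1`).  IMPORTS BY NAME: r03's
`ineq2110`, `ineq2109_upper`/`ineq2109_top` and `…B6Hprime2101TorusAlgebra.eq2107_typed` ((2.107) `HpOpᴴ·Δ·Δ·HpOp = n^d·dPOp`), gen 9's
`…B6Hprime2101TwoScaleV1Torus.transport_hP_eq_HpOp` / `re_star_LapS_transport` / `lapE_eq_smul`, p21's `B5TowerOneStroke.trS` /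
`B5HkOpLandauMin.star_trS_dotProduct_trS` / `star_cplxS_dotProduct_cplxS`, r02's carrier `…B5Eq112TorusCarriers.eSite` (`Site P j ≃
Tor (fine L (Mc P j))`, the componentwise `recast`) with `QsLin_trS` / `cplxS_QsLin` (the constraint `Q′₁ω = 0`), `…B6SectCTwoScaleV1.siteAvg_admissible`.
THIS FILE:
* §1 `ineq2110_of_neZero` (r03's (2.110) with the block size as a `NeZero` natural instead of `k + 1`); `dPOp_mulVec_trS_recast` (the typed
  `Δ′_j`, defined uniformly in the torus periods, commutes with the `recast` along equal periods);
* §2 **`inner_Dp_eq`**: for the two-scale data, `⟨ω, Δ′_jω⟩ = ‖ΔH′_jω‖²` ((2.107) as a form) and **`inner_Dp_eq_dPOp`**: `⟨ω, Δ′_jω⟩ =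
  (c/L^j)⁴·L^{jd}·Re⟨ω̃, dPOp (L^j) ω̃⟩`, `ω̃` the complexified `ω` — the concrete `Δ′_j` IS r03's typed one up to the displayed normalisation;
* §3 **`ineq2110_V1`**: for `ω` admissible (*"ω defined on Λ"*, `Q′₁ω = 0` on `Λ′` — hence `Q′₁ω = 0` everywhere),
  `θ·c₀(d)(8/L²)²‖ω‖² ≤ ⟨ω, Δ′_jω⟩` and, for every `ω`, `⟨ω, Δ′_jω⟩ ≤ θ·γ₁(d)‖ω‖²`, `θ = (c/L^j)⁴L^{jd}` (`ineq2110_V1_lower`, `ineq2110_V1_upper`,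
  `gamma0_V1_pos`).
THEOREMS ONLY (no definition, no `def … : Prop` fact); standard axioms.  HONEST SCOPE: the constants are r03's `c₀(d)·(8/L²)²` and `γ₁(d)`
(d and L only) times the normalisation `θ = (c/L^j)⁴L^{jd}` of the V1 Laplacian weight `c` and of the `ℓ²` (volume-factor-free) pairings of the
V1 carriers (print works at unit-lattice normalisation, `θ = 1`); the *"exponential decay of Δ′_j(y − y′)"* clause is NOT addressed; finite tori of
the V1 calculus, centred blocks (`L` odd); NOT summit progress.
-/

noncomputable section

open scoped InnerProductSpace Matrix ComplexConjugate

namespace Literature.MathematicalPhysics.QuantumFieldTheory.Balaban1983to89.B6Ineq2110TwoScaleV1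

open LatticeFieldCalculus B5SectBStatements B5Eq117TorusCarriers B6SectAOperatorsV1 B6SectCTwoScaleV1 B6SectCTwoScaleV1Lattice
open B6SectCOperators (TwoScaleData)
open B5Prop11Plancherel (Tor fine)
open B5Composition116 (recast recast_apply)
open B5Action121 (LapS)
open B5Block118 (QsOp)
open B5LaplaceSpectral (LapS_isHermitian)
open B5TowerOneStroke (towerE trS trS_apply')
open B5HkOpLandauMin (star_trS_dotProduct_trS star_cplxS_dotProduct_cplxS)
open B6Hprime2132Torus (HpOp)
open B6Hprime2101 (c0_2109 gamma1_2109 c0_2109_pos)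
open B6Hprime2101TorusAlgebra (dPOp eq2107_typed)
open B6DeltaPrime2109Torus (ineq2109_upper ineq2109_top)
open B6DeltaPrime2110Torus (ineq2110)
open B6Hprime2101TwoScaleV1Torus (transport_hP_eq_HpOp re_star_LapS_transport lapE_eq_smul)
open B5Eq112TorusCarriers (Mc eSite sitesPerDir_eq_fine QsLin_trS)

variable {d : ℕ}

/-! ## §1  r03's (2.110) with the block size as a `NeZero` natural; the typed `Δ′_j` commutes with `recast` -/

/-- **(2.110) for the typed `Δ′_j`** (r03's `ineq2110`), the block size written as a `NeZero` natural `L` instead of `k + 1`.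
[cite: Balaban1984PropagatorsII, (2.110) p.242] -/
theorem ineq2110_of_neZero (n L : ℕ) [NeZero n] [NeZero L] (M : Fin d → ℕ) [∀ μ, NeZero (M μ)]
    (ω : Tor (fine L M) → ℂ) (hQ : QsOp L M *ᵥ ω = 0) :
    c0_2109 d * (8 / (L : ℝ) ^ 2) ^ 2 * (star ω ⬝ᵥ ω).re ≤ (star ω ⬝ᵥ (dPOp n (fine L M) *ᵥ ω)).re ∧
      (star ω ⬝ᵥ (dPOp n (fine L M) *ᵥ ω)).re ≤ gamma1_2109 d * (star ω ⬝ᵥ ω).re := by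
  obtain ⟨k, rfl⟩ : ∃ k, L = k + 1 := ⟨L - 1, by have := NeZero.ne L; omega⟩
  have h := ineq2110 n k M ω hQ
  push_cast at h ⊢
  exact h

/-- the typed `Δ′_j` (2.108), defined uniformly in the torus periods, commutes with the identification `recast` of tori with equal periods.
[cite: Balaban1984PropagatorsII, (2.108) p.242] -/
theorem dPOp_mulVec_trS_recast {N N' : Fin d → ℕ} [∀ μ, NeZero (N μ)] [∀ μ, NeZero (N' μ)] (h : ∀ ν, N ν = N' ν)
    (n : ℕ) [NeZero n] (f : Tor N → ℂ) :
    dPOp n N' *ᵥ trS (recast h) f = trS (recast h) (dPOp n N *ᵥ f) := by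
  obtain rfl : N = N' := funext h
  have hr : recast h = Equiv.refl (Tor N) := by
    ext x ν
    rw [recast_apply]
    simp
  have ht : ∀ g : Tor N → ℂ, trS (recast h) g = g := fun g => by
    funext x
    rw [trS_apply', hr]
    rfl
  rw [ht, ht]

/-- matrix algebra: `⟨Av, Av⟩ = ⟨v, (AᴴA)v⟩`. [folklore] -/
private theorem star_mulVec_dotProduct_mulVec {m k : Type*} [Fintype m] [Fintype k] (A : Matrix m k ℂ) (v : k → ℂ) :
    star (A *ᵥ v) ⬝ᵥ (A *ᵥ v) = star v ⬝ᵥ ((Aᴴ * A) *ᵥ v) := by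
  rw [Matrix.star_mulVec, Matrix.dotProduct_mulVec, Matrix.vecMul_vecMul, ← Matrix.dotProduct_mulVec]

/-! ## §2  The concrete `Δ′_j` of the two-scale data against r03's typed operator -/

section V1

variable {P : Params} {c : ℝ} (hc : c ≠ 0) {j : ℕ} (Λ' : Finset (Site P (j + 1))) (w : CIdx j Λ' → ℝ)

/-- **(2.107) as a form for the two-scale data**: `⟨ω, Δ′_jω⟩ = ⟨ΔH′_jω, ΔH′_jω⟩ = ‖ΔH′_jω‖²` (`Δ = lapE c`, `H′_j = hP`).
[cite: Balaban1984PropagatorsII, (2.107) p.242] -/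
theorem inner_Dp_eq (ω : USite P j) :
    ⟪ω, (tsV1 hc Λ' w).Dp ω⟫_ℝ = ‖lapE c (hP hc j ω)‖ ^ 2 := by
  rw [TwoScaleData.Dp]
  simp only [LinearMap.coe_comp, Function.comp_apply]
  rw [LinearMap.adjoint_inner_right, ← real_inner_self_eq_norm_sq]
  show ⟪hP hc j ω, lapE c (lapE c (hP hc j ω))⟫_ℝ = ⟪lapE c (hP hc j ω), lapE c (hP hc j ω)⟫_ℝ
  rw [inner_lapE_right c (hP hc j ω) (lapE c (hP hc j ω)), inner_lapE_right c (lapE c (hP hc j ω)) (hP hc j ω), real_inner_comm]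

omit hc in
/-- the Laplacian weight: `‖lapE c f‖² = (c/L^k)⁴‖lapE (L^k) f‖²` for every `k`. [cite: Balaban1984PropagatorsII, (2.8) p.224] -/
theorem norm_lapE_sq_eq (k : ℕ) (f : ScalarSpace P) :
    ‖lapE c f‖ ^ 2 = (c / (P.L : ℝ) ^ k) ^ 4 * ‖lapE ((P.L : ℝ) ^ k) f‖ ^ 2 := by
  have hL : (0 : ℝ) < (P.L : ℝ) ^ k := pow_pos P.cast_L_pos _
  have h1 : lapE c f = (c / (P.L : ℝ) ^ k) ^ 2 • lapE ((P.L : ℝ) ^ k) f := by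
    rw [lapE_eq_smul c, lapE_eq_smul ((P.L : ℝ) ^ k), smul_smul]
    congr 1
    field_simp
  rw [h1, norm_smul, mul_pow, Real.norm_eq_abs, sq_abs]
  ring

/-- **the concrete `Δ′_j` is r03's typed one**: `⟨ω, Δ′_jω⟩ = (c/L^j)⁴·L^{jd}·Re⟨ω̃, dPOp (L^j) (Mk P j) ω̃⟩`, `ω̃ = cplxS (tSc ω)` the complexified
unit-lattice field ((2.107) for the concrete operators = r03's `eq2107_typed` after gen 9's `(H′_jμ)~ = HpOp·μ̃` and `‖Δλ̃‖² = ‖lapE (L^j) λ‖²`).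
[cite: Balaban1984PropagatorsII, (2.107)–(2.108) p.242] -/
theorem inner_Dp_eq_dPOp (hj : j ≤ P.m + P.K) (ω : USite P j) :
    ⟪ω, (tsV1 hc Λ' w).Dp ω⟫_ℝ = (c / (P.L : ℝ) ^ j) ^ 4 * ((P.L : ℝ) ^ j) ^ P.d *
      (star (cplxS (tSc (WithLp.ofLp ω))) ⬝ᵥ (dPOp (P.L ^ j) (Mk P j) *ᵥ cplxS (tSc (WithLp.ofLp ω)))).re := by
  have h2 : ∀ v : Tor (Mk P j) → ℂ,
      star (LapS (fine (P.L ^ j) (Mk P j)) ((P.L ^ j : ℕ) : ℂ) *ᵥ (HpOp (P.L ^ j) (Mk P j) *ᵥ v)) ⬝ᵥ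
          (LapS (fine (P.L ^ j) (Mk P j)) ((P.L ^ j : ℕ) : ℂ) *ᵥ (HpOp (P.L ^ j) (Mk P j) *ᵥ v)) =
        ((P.L ^ j : ℕ) : ℂ) ^ P.d * (star v ⬝ᵥ (dPOp (P.L ^ j) (Mk P j) *ᵥ v)) := by
    intro v
    have h7 := eq2107_typed (P.L ^ j) (Mk P j)
    simp only [Matrix.mul_assoc] at h7
    rw [Matrix.mulVec_mulVec, star_mulVec_dotProduct_mulVec, Matrix.conjTranspose_mul, (LapS_isHermitian _ _).eq,
      Matrix.mul_assoc, h7, Matrix.smul_mulVec, dotProduct_smul, smul_eq_mul]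
  have hcast : ((P.L ^ j : ℕ) : ℂ) ^ P.d = ((((P.L : ℝ) ^ j) ^ P.d : ℝ) : ℂ) := by push_cast; ring
  rw [inner_Dp_eq, norm_lapE_sq_eq j, ← re_star_LapS_transport hj (hP hc j ω), transport_hP_eq_HpOp hc hj ω, h2, hcast,
    Complex.re_ofReal_mul]
  ring

/-! ## §3  (2.110) for the concrete `Δ′_j` of the two-scale data -/

omit hc in
/-- the `ℓ²` pairing of the complexified unit-lattice field is `‖ω‖²`. [folklore] -/
private theorem re_star_dotProduct_self (ω : USite P j) :
    (star (cplxS (tSc (WithLp.ofLp ω))) ⬝ᵥ cplxS (tSc (WithLp.ofLp ω))).re = ‖ω‖ ^ 2 := by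
  rw [star_cplxS_dotProduct_cplxS, Complex.ofReal_re, ← real_inner_self_eq_norm_sq]
  rfl

/-- **(2.110), UPPER HALF, for the concrete `Δ′_j` of the two-scale data**: `⟨ω, Δ′_jω⟩ ≤ θ·γ₁(d)·‖ω‖²` for every `ω`, `θ = (c/L^j)⁴L^{jd}`
(from (2.109) on the unit torus, via `inner_Dp_eq_dPOp`). [cite: Balaban1984PropagatorsII, (2.109)–(2.110) p.242] -/
theorem ineq2110_V1_upper (hj : j ≤ P.m + P.K) (ω : USite P j) :
    ⟪ω, (tsV1 hc Λ' w).Dp ω⟫_ℝ ≤ (c / (P.L : ℝ) ^ j) ^ 4 * ((P.L : ℝ) ^ j) ^ P.d * gamma1_2109 P.d * ‖ω‖ ^ 2 := by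
  rw [inner_Dp_eq_dPOp hc Λ' w hj ω]
  have h := (ineq2109_upper (Mk P j) (P.L ^ j) (cplxS (tSc (WithLp.ofLp ω)))).trans
    (ineq2109_top (Mk P j) (cplxS (tSc (WithLp.ofLp ω))))
  rw [re_star_dotProduct_self] at h
  have hθ : 0 ≤ (c / (P.L : ℝ) ^ j) ^ 4 * ((P.L : ℝ) ^ j) ^ P.d := by positivity
  calc _ ≤ (c / (P.L : ℝ) ^ j) ^ 4 * ((P.L : ℝ) ^ j) ^ P.d * (gamma1_2109 P.d * ‖ω‖ ^ 2) := mul_le_mul_of_nonneg_left h hθ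
    _ = _ := by ring

/-- **(2.110), LOWER HALF, for the concrete `Δ′_j` of the two-scale data**: for `ω` admissible (`ω` supported on `B(Λ′)`, `Q′₁ω = 0` on `Λ′`
— hence `Q′₁ω = 0` on the whole unit torus), `θ·c₀(d)(8/L²)²·‖ω‖² ≤ ⟨ω, Δ′_jω⟩`, `θ = (c/L^j)⁴L^{jd}` — r03's `ineq2110` transported along
`T^{(j)} ≃ Tor (L·Mc)`. [cite: Balaban1984PropagatorsII, (2.110) p.242] -/
theorem ineq2110_V1_lower (hj : j + 1 ≤ P.m + P.K) (ω : USite P j) (hω : ω ∈ admissible P j Λ') :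
    (c / (P.L : ℝ) ^ j) ^ 4 * ((P.L : ℝ) ^ j) ^ P.d * (c0_2109 P.d * (8 / (P.L : ℝ) ^ 2) ^ 2) * ‖ω‖ ^ 2 ≤
      ⟪ω, (tsV1 hc Λ' w).Dp ω⟫_ℝ := by
  rw [inner_Dp_eq_dPOp hc Λ' w (by omega) ω]
  set μf : Tor (Mk P j) → ℂ := cplxS (tSc (WithLp.ofLp ω)) with hμf
  set ω' : Tor (fine P.L (Mc P j)) → ℂ := trS (eSite hj) μf with hω'
  have h1 : star ω' ⬝ᵥ ω' = star μf ⬝ᵥ μf := star_trS_dotProduct_trS _ _ _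
  have h2 : star ω' ⬝ᵥ (dPOp (P.L ^ j) (fine P.L (Mc P j)) *ᵥ ω') = star μf ⬝ᵥ (dPOp (P.L ^ j) (Mk P j) *ᵥ μf) := by
    have hd : dPOp (P.L ^ j) (fine P.L (Mc P j)) *ᵥ ω' = trS (eSite hj) (dPOp (P.L ^ j) (Mk P j) *ᵥ μf) :=
      dPOp_mulVec_trS_recast (sitesPerDir_eq_fine hj) (P.L ^ j) μf
    rw [hd, hω', star_trS_dotProduct_trS]
  have hQ : QsOp P.L (Mc P j) *ᵥ ω' = 0 := by
    have hsa : siteAvg (WithLp.ofLp ω) = 0 := funext fun Y => siteAvg_admissible j Λ' hj hω Y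
    have e1 : ω' = cplxS (B5Eq112TorusCarriers.trS hj (WithLp.ofLp ω)) := by
      funext x
      rfl
    rw [e1, ← cplxS_QsLin, QsLin_trS, hsa, map_zero]
    funext x
    simp [cplxS]
  have h := (ineq2110_of_neZero (P.L ^ j) P.L (Mc P j) ω' hQ).1
  rw [h1, h2, hμf, re_star_dotProduct_self] at h
  have hθ : 0 ≤ (c / (P.L : ℝ) ^ j) ^ 4 * ((P.L : ℝ) ^ j) ^ P.d := by positivity
  calc _ = (c / (P.L : ℝ) ^ j) ^ 4 * ((P.L : ℝ) ^ j) ^ P.d * (c0_2109 P.d * (8 / (P.L : ℝ) ^ 2) ^ 2 * ‖ω‖ ^ 2) := by ring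
    _ ≤ _ := mul_le_mul_of_nonneg_left h hθ

/-- **(2.110) for the concrete `Δ′_j = H′_j*Δ²H′_j` of the two-scale data `tsV1`**: *"γ₀‖ω‖² ≤ ⟨ω, Δ′_jω⟩ ≤ γ₁‖ω‖² for ω : Q′₁ω = 0, with
positive constants γ₀, γ₁ dependent on d and L only"* — here `γ₀ = θ·c₀(d)(8/L²)²`, `γ₁ = θ·γ₁(d)`, `θ = (c/L^j)⁴L^{jd}` the normalisation of
the V1 carriers, for the admissible `ω` of the data (`Q′₁ω = 0`). [cite: Balaban1984PropagatorsII, (2.110) p.242] -/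
theorem ineq2110_V1 (hj : j + 1 ≤ P.m + P.K) (ω : USite P j) (hω : ω ∈ admissible P j Λ') :
    (c / (P.L : ℝ) ^ j) ^ 4 * ((P.L : ℝ) ^ j) ^ P.d * (c0_2109 P.d * (8 / (P.L : ℝ) ^ 2) ^ 2) * ‖ω‖ ^ 2 ≤
        ⟪ω, (tsV1 hc Λ' w).Dp ω⟫_ℝ ∧
      ⟪ω, (tsV1 hc Λ' w).Dp ω⟫_ℝ ≤ (c / (P.L : ℝ) ^ j) ^ 4 * ((P.L : ℝ) ^ j) ^ P.d * gamma1_2109 P.d * ‖ω‖ ^ 2 :=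
  ⟨ineq2110_V1_lower hc Λ' w hj ω hω, ineq2110_V1_upper hc Λ' w (by omega) ω⟩

omit Λ' w in
include hc in
/-- the lower constant `γ₀ = θ·c₀(d)(8/L²)²` is positive (`c ≠ 0`). [cite: Balaban1984PropagatorsII, (2.110) p.242] -/
theorem gamma0_V1_pos : 0 < (c / (P.L : ℝ) ^ j) ^ 4 * ((P.L : ℝ) ^ j) ^ P.d * (c0_2109 P.d * (8 / (P.L : ℝ) ^ 2) ^ 2) := by
  have hL := P.cast_L_pos
  have h4 : 0 < (c / (P.L : ℝ) ^ j) ^ 4 := Even.pow_pos ⟨2, rfl⟩ (div_ne_zero hc (pow_ne_zero _ hL.ne'))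
  exact mul_pos (mul_pos h4 (pow_pos (pow_pos hL _) _)) (mul_pos (c0_2109_pos P.d) (by positivity))

end V1

end Literature.MathematicalPhysics.QuantumFieldTheory.Balaban1983to89.B6Ineq2110TwoScaleV1

end
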